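import Summits.KontsevichZagierPeriods.KontsevichZagierPeriods.Theorems.LinRedNormalFormArrangementNormalFormStubSeparateZeroFibreMass
import Summits.KontsevichZagierPeriods.KontsevichZagierPeriods.Theorems.LinRedNormalFormArrangementNormalFormStubSeparateZeroPartialFractions

/-!
# Stub `stub_separateZero` (crux `ArrangementNormalForm`, line `janus-bands`) — the stub

`stub_separateZero` (skeleton v3 of crux `ArrangementNormalForm`, line `janus-bands`): a Janus band
representation of base dimension `1` is congruent modulo `KZ.relations` to a `ℤ`-combination of
elements of `GG 0 1 k`. Remove the null pole hyperplanes (rule 1a), split the integrand by the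
partial fraction decomposition of its rational part with CONSTANT rational coefficients (rule 1b,
`KZ.of_sub_sum_integrand_mem_relations`) — every term converges absolutely: the letter block is
integrable by the FIBRE-MASS theorem (part `FibreMass`), polar terms of order at most `E μ − ρ_μ`
by domination at the pole (part `Poles`) — and put the hyperplanes back (null modification).
Degenerate data (zero numerator, a row `0·y+0` with positive exponent) have zero integrand.

References: M. Kontsevich, D. Zagier, *Periods* (2001), §1.2.
-/

noncomputable section

open Set MeasureTheory Polynomial
open Literature.NumberTheory.Transcendental
open Literature.ModelTheory.ExponentialFields (IsSemialgebraic)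
open scoped ENNReal

namespace Summit.KontsevichZagierPeriods.ArrangementNormalForm.JanusBands

namespace SepZero

variable {k : ℕ}

/-! ### The atoms of a datum -/

/-- The finite set of atoms occurring in the bounds and letters. -/
def atoms (lo hi : Fin k → Fin k ⊕ Atom) (a : Fin k → Option Atom) : Finset Atom :=
  Finset.univ.biUnion fun i => (Sum.elim (fun _ => (∅ : Finset Atom)) (fun c => {c}) (lo i) ∪
    Sum.elim (fun _ => (∅ : Finset Atom)) (fun c => {c}) (hi i)) ∪ (a i).elim ∅ (fun c => {c})

/-- Lower bound atoms are atoms. -/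
theorem lo_mem_atoms {lo hi : Fin k → Fin k ⊕ Atom} {a : Fin k → Option Atom} (i : Fin k) (c : Atom)
    (h : lo i = Sum.inr c) : c ∈ atoms lo hi a := by
  simp only [atoms, Finset.mem_biUnion, Finset.mem_univ, true_and, Finset.mem_union]
  exact ⟨i, Or.inl (Or.inl (by rw [h]; simp))⟩

/-- Upper bound atoms are atoms. -/
theorem hi_mem_atoms {lo hi : Fin k → Fin k ⊕ Atom} {a : Fin k → Option Atom} (i : Fin k) (c : Atom)
    (h : hi i = Sum.inr c) : c ∈ atoms lo hi a := by
  simp only [atoms, Finset.mem_biUnion, Finset.mem_univ, true_and, Finset.mem_union]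
  exact ⟨i, Or.inl (Or.inr (by rw [h]; simp))⟩

/-- Letters are atoms. -/
theorem letter_mem_atoms {lo hi : Fin k → Fin k ⊕ Atom} {a : Fin k → Option Atom} (i : Fin k)
    (c : Atom) (h : a i = some c) : c ∈ atoms lo hi a := by
  simp only [atoms, Finset.mem_biUnion, Finset.mem_univ, true_and, Finset.mem_union]
  exact ⟨i, Or.inr (by rw [h]; simp)⟩


/-- **The congruence.** A Janus band representation of base dimension one is congruent modulo
`KZ.relations` to a `ℤ`-combination of elements of `GG 0 1 k`: remove the (null) pole
hyperplanes, split the integrand by the partial fraction decomposition of its rational part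
(rule 1b; every term converges absolutely by the fibre-mass theorem and domination at the poles),
and put the pole hyperplanes back. -/
theorem main_congruence {m m' : ℕ} (s : KZ.IntegralRep (1 + k)) (M : Fin m' → Atom)
    (L : Fin m → Atom) (e : Fin m → ℕ) (p : MvPolynomial (Fin 1) ℚ) (a : Fin k → Option Atom)
    (lo hi : Fin k → Fin k ⊕ Atom) (hbd : Bornology.IsBounded s.domain)
    (hdom : s.domain = {z | (∀ j, 0 < ∑ i, ((M j).1 i : ℝ) * z (Fin.castAdd k i) + ((M j).2 : ℝ)) ∧ ∀ i, Sum.elim (fun j => z (Fin.natAdd 1 j)) (fun c => ∑ i', (c.1 i' : ℝ) * z (Fin.castAdd k i') + (c.2 : ℝ)) (lo i) < z (Fin.natAdd 1 i) ∧ z (Fin.natAdd 1 i) < Sum.elim (fun j => z (Fin.natAdd 1 j)) (fun c => ∑ i', (c.1 i' : ℝ) * z (Fin.castAdd k i') + (c.2 : ℝ)) (hi i)})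
    (hint : EqOn s.integrand (fun z => MvPolynomial.aeval (fun i => z (Fin.castAdd k i)) p / (∏ j, (∑ i, ((L j).1 i : ℝ) * z (Fin.castAdd k i) + ((L j).2 : ℝ)) ^ e j) * ∏ i, (a i).elim 1 (fun c => 1 / (z (Fin.natAdd 1 i) - (∑ i', (c.1 i' : ℝ) * z (Fin.castAdd k i') + (c.2 : ℝ))))) s.domain) :
    ∃ c ∈ AddSubgroup.closure (GGlit 0 1 k), KZ.of s - c ∈ KZ.relations := by
  classical
  -- dictionary
  set Yb : Set ℝ := {y | ∀ j, 0 < av (M j) y} with hYb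
  set D := dom Yb lo hi with hD
  have hdomD : s.domain = D := by
    rw [hdom, hD]; ext z
    simp only [dom, mem_setOf_eq, Fin.sum_univ_one, av, hYb]
    rfl
  set P := toPoly p with hP_def
  have hintD : EqOn s.integrand (fun z => Rf P L e (z (bo k)) * LB a z) D := fun z hz => by
    rw [hint (show z ∈ s.domain by rw [hdomD]; exact hz)]
    exact literal_integrand_eq p L e a z
  -- degenerate data: the integrand vanishes
  by_cases hdeg : P = 0 ∨ ¬ RowsOK L e
  · refine ⟨0, zero_mem _, ?_⟩
    rw [sub_zero]
    refine KZ.of_mem_relations_of_eqOn_zero s fun z hz => ?_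
    have hzD : z ∈ D := by rw [← hdomD]; exact hz
    rw [hintD hzD]
    show Rf P L e (z (bo k)) * LB a z = 0
    rcases hdeg with h0 | hrow
    · simp [Rf, h0]
    · obtain ⟨j, hα, hβ, hej⟩ : ∃ j, (L j).1 0 = 0 ∧ (L j).2 = 0 ∧ e j ≠ 0 := by
        simpa [RowsOK] using hrow
      have hQ : Qf L e (z (bo k)) = 0 :=
        Finset.prod_eq_zero (Finset.mem_univ j) (by simp [hα, hβ, zero_pow hej])
      simp [Rf, hQ]
  push Not at hdeg
  obtain ⟨hP, hrows⟩ := hdeg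
  -- bounds, measurability, semialgebraicity
  obtain ⟨Lb, hLb⟩ := hbd.exists_norm_le
  have hL : ∀ z ∈ D, ∀ j, |z j| ≤ Lb := fun z hz j => by
    have h1 := hLb z (by rw [hdomD]; exact hz)
    have h2 := norm_le_pi_norm z j
    rw [Real.norm_eq_abs] at h2
    exact h2.trans h1
  have hYbm : MeasurableSet Yb := by
    have : Yb = ⋂ j, {y | 0 < av (M j) y} := by ext y; simp [hYb]
    rw [this]; exact MeasurableSet.iInter fun j => measurableSet_lt measurable_const (measurable_av _)
  have hDm : MeasurableSet D := measurableSet_dom hYbm lo hi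
  have hDsa : IsSemialgebraic ℚ D := by rw [← hdomD]; exact s.isSemialgebraic_domain
  -- absolute convergence: R·LB (given), LB (fibre mass), poles (domination)
  have hRB : IntegrableOn (fun z => Rf P L e (z (bo k)) * LB a z) D := by
    have h := s.integrableOn; rw [hdomD] at h
    exact h.congr_fun hintD hDm
  have hWB : IntegrableOn (fun z => (P.map (algebraMap ℚ ℝ)).eval (z (bo k)) * LB a z) D := by
    have hQf : Measurable (Qf L e) := by
      unfold Qf
      exact Finset.measurable_prod _ fun j _ =>
        ((measurable_const.mul measurable_id).add_const _).pow_const _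
    have hQm : AEStronglyMeasurable (fun z : Fin (1 + k) → ℝ => Qf L e (z (bo k)))
        (volume.restrict D) := (hQf.comp (measurable_pi_apply _)).aestronglyMeasurable
    have h1 : IntegrableOn (fun z => Qf L e (z (bo k)) * (Rf P L e (z (bo k)) * LB a z)) D := by
      refine hRB.bdd_mul (c := |(kap L e : ℝ)| * ∏ j, (|Lb| + |(root (L j) : ℝ)| + 1) ^ dz L e j) hQm ?_
      filter_upwards [ae_restrict_mem hDm] with z hz
      rw [Real.norm_eq_abs, Qf_eq, abs_mul]
      exact mul_le_mul_of_nonneg_left (abs_prod_root_le L e _ (hL z hz _)) (abs_nonneg _)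
    refine h1.congr_fun_ae ?_
    filter_upwards [ae_restrict_mem hDm,
      ae_restrict_of_ae (measure_eq_zero_iff_ae_notMem.1 (volume_Npol k L))] with z _ hzN
    have hQ : Qf L e (z (bo k)) ≠ 0 := by
      rw [Qf_eq]
      exact mul_ne_zero (by exact_mod_cast kap_ne_zero hrows)
        (prod_root_ne_zero L e fun j hj h => hzN ⟨j, hj, h⟩)
    rw [Polynomial.eval_map_algebraMap, Rf]
    field_simp
  have hLB : IntegrableOn (LB a) D :=
    integrableOn_LB hYbm (S := atoms lo hi a) (fun i c h => lo_mem_atoms i c h)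
      (fun i c h => hi_mem_atoms i c h) a (fun i c h => letter_mem_atoms i c h) hL
      (P.map (algebraMap ℚ ℝ)) ((Polynomial.map_ne_zero_iff (algebraMap ℚ ℝ).injective).2 hP) hWB
  have hpole := integrableOn_pole_mul_LB hDm a P hP L e hrows hL hLB hRB
  -- partial fractions of the rational part, off the pole hyperplanes
  obtain ⟨nT, T, hTok, hTid⟩ := pf_exists P L e _ (dz L e) (kap L e)⁻¹ rfl (fun j => le_rfl)
  set D' := D \ Npol k L with hD'
  have hD'sa : IsSemialgebraic ℚ D' := hDsa.diff (isSemialgebraic_Npol k L)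
  have hD'D : D' ⊆ D := Set.sdiff_subset
  have hvolDD' : volume (D \ D') = 0 := by
    rw [hD', Set.sdiff_sdiff_right_self]
    exact measure_mono_null inter_subset_right (volume_Npol k L)
  have hident : ∀ z ∈ D', Rf P L e (z (bo k)) = ∑ l, tev (T l) (z (bo k)) := by
    intro z hz
    have hroots : ∀ j, (L j).1 0 ≠ 0 → z (bo k) ≠ root (L j) := fun j hj h => hz.2 ⟨j, hj, h⟩
    have hy : ∀ j, dz L e j ≠ 0 → z (bo k) ≠ root (L j) := fun j hj =>
      hroots j (by intro h; apply hj; simp [dz, h])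
    rw [← hTid _ hy, Rf, Qf_eq]
    have hprod := prod_root_ne_zero L e hroots
    have hκ : (kap L e : ℝ) ≠ 0 := by exact_mod_cast kap_ne_zero hrows
    have hinv : ∏ j, (1 / (z (bo k) - (root (L j) : ℝ))) ^ dz L e j =
        (∏ j, (z (bo k) - root (L j)) ^ dz L e j)⁻¹ := by
      simp [one_div, inv_pow, Finset.prod_inv_distrib]
    rw [hinv]
    push_cast
    field_simp
  -- the term representations on `D` and their restrictions to `D'`
  let tR : Fin nT → KZ.IntegralRep (1 + k) := fun l =>
    { domain := D
      integrand := fun z => tev (T l) (z (bo k)) * LB a z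
      isSemialgebraic_domain := hDsa
      isSemialgebraicFunOn_integrand := isSemialgebraicFunOn_tev_mul_LB hDsa (T l) a
      integrableOn := integrableOn_tev_mul_LB hDm a P L e hL hLB hpole (T l) (hTok l) }
  let R : Fin nT → KZ.IntegralRep (1 + k) := fun l => (tR l).restrict D' hD'sa hD'D
  have hsD' : D' ⊆ s.domain := by rw [hdomD]; exact hD'D
  let r' := s.restrict D' hD'sa hsD'
  have e1 : KZ.of s - KZ.of r' ∈ KZ.relations :=
    KZ.IntegralRep.of_sub_of_restrict_mem_relations s hD'sa hsD' (by rw [hdomD]; exact hvolDD')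
  have e2 : KZ.of r' - ∑ l, KZ.of (R l) ∈ KZ.relations := by
    refine KZ.of_sub_sum_integrand_mem_relations Finset.univ R r' (fun l _ => rfl) fun z hz => ?_
    show s.integrand z = ∑ l, tev (T l) (z (bo k)) * LB a z
    rw [hintD (hD'D hz)]
    show Rf P L e (z (bo k)) * LB a z = _
    rw [hident z hz, Finset.sum_mul]
  have e3 : ∀ l, KZ.of (tR l) - KZ.of (R l) ∈ KZ.relations := fun l =>
    KZ.IntegralRep.of_sub_of_restrict_mem_relations (tR l) hD'sa hD'D hvolDD'
  have hbdD : Bornology.IsBounded D := by rw [← hdomD]; exact hbd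
  refine ⟨∑ l, KZ.of (tR l), AddSubgroup.sum_mem _ fun l _ => AddSubgroup.subset_closure
    (mem_GGlit M lo hi a (tR l) hbdD (hdomD.symm.trans hdom) (T l) (hTok l).1 fun z => rfl), ?_⟩
  have : KZ.of s - ∑ l, KZ.of (tR l) = (KZ.of s - KZ.of r') + (KZ.of r' - ∑ l, KZ.of (R l)) -
      ∑ l, (KZ.of (tR l) - KZ.of (R l)) := by
    rw [Finset.sum_sub_distrib]; abel
  rw [this]
  exact KZ.relations.sub_mem (KZ.relations.add_mem e1 e2) (AddSubgroup.sum_mem _ fun l _ => e3 l)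

end SepZero

/-- **stub_separateZero.** Base dimension `1` (no `x'`): partial fractions in `y` of
`p(y)/∏ⱼ(αⱼy+βⱼ)^{eⱼ}` have CONSTANT coefficients (no walls); every term
`c·(y−λ)^{±m}·(fibre block)` is absolutely convergent by domination at the poles of its own
order (lowest terms) and, elsewhere, by the FIBRE-MASS theorem (`SepZero.integrableOn_LB`: the
letter block of a bounded Janus band is absolutely integrable as soon as `P(y)·(letter block)` is,
for a nonzero polynomial `P`; proved by power counting on the pieces of a total-order dissection
and a divergence lemma on the bad pieces). Rule 1b (`KZ.of_sub_sum_integrand_mem_relations`)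
after removing the null pole hyperplanes (rule 1a). -/
theorem stub_separateZero (JJ : ℕ → ℕ → Set KZ.FormalRep) (GG : ℕ → ℕ → ℕ → Set KZ.FormalRep) (hJJ : ∀ b k, JJ b k = {w : KZ.FormalRep | ∃ (m m' : ℕ) (s : KZ.IntegralRep (b + k)) (M : Fin m' → (Fin b → ℚ) × ℚ) (L : Fin m → (Fin b → ℚ) × ℚ) (e : Fin m → ℕ) (p : MvPolynomial (Fin b) ℚ) (a : Fin k → Option ((Fin b → ℚ) × ℚ)) (lo hi : Fin k → Fin k ⊕ ((Fin b → ℚ) × ℚ)), Bornology.IsBounded s.domain ∧ s.domain = {z | (∀ j, 0 < ∑ i, ((M j).1 i : ℝ) * z (Fin.castAdd k i) + ((M j).2 : ℝ)) ∧ ∀ i, Sum.elim (fun j => z (Fin.natAdd b j)) (fun c => ∑ i', (c.1 i' : ℝ) * z (Fin.castAdd k i') + (c.2 : ℝ)) (lo i) < z (Fin.natAdd b i) ∧ z (Fin.natAdd b i) < Sum.elim (fun j => z (Fin.natAdd b j)) (fun c => ∑ i', (c.1 i' : ℝ) * z (Fin.castAdd k i') + (c.2 : ℝ)) (hi i)}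 ∧ EqOn s.integrand (fun z => MvPolynomial.aeval (fun i => z (Fin.castAdd k i)) p / (∏ j, (∑ i, ((L j).1 i : ℝ) * z (Fin.castAdd k i) + ((L j).2 : ℝ)) ^ e j) * ∏ i, (a i).elim 1 (fun c => 1 / (z (Fin.natAdd b i) - (∑ i', (c.1 i' : ℝ) * z (Fin.castAdd k i') + (c.2 : ℝ))))) s.domain ∧ w = KZ.of s}) (hGG : ∀ b σ k, GG b σ k = {w : KZ.FormalRep | ∃ (m m' n₁ n₂ : ℕ) (s : KZ.IntegralRep (b + 1 + k)) (M : Fin m' → (Fin (b + 1) → ℚ) × ℚ) (L : Fin m → (Fin b → ℚ) × ℚ) (e : Fin m → ℕ) (p : MvPolynomial (Fin b) ℚ) (ℓ₁ ℓ₂ : (Fin b → ℚ) × ℚ) (a : Fin k → Option ((Fin (b + 1) → ℚ) × ℚ)) (lo hi : Fin k → Fin k ⊕ ((Fin (b + 1) → ℚ) × ℚ)), (n₁ = 0 ∨ n₂ = 0) ∧ (σ = 2 → (∀ i c, a i = some c → c.1 (Fin.last b) = 0) ∧ (∀ i c, (lo i = Sum.inr c ∨ hi i = Sum.inr c) → (c.1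 (Fin.last b) = 0 ∨ c = (Pi.single (Fin.last b) 1, 0)))) ∧ Bornology.IsBounded s.domain ∧ s.domain = {z | (∀ j, 0 < ∑ i, ((M j).1 i : ℝ) * z (Fin.castAdd k i) + ((M j).2 : ℝ)) ∧ ∀ i, Sum.elim (fun j => z (Fin.natAdd (b + 1) j)) (fun c => ∑ i', (c.1 i' : ℝ) * z (Fin.castAdd k i') + (c.2 : ℝ)) (lo i) < z (Fin.natAdd (b + 1) i) ∧ z (Fin.natAdd (b + 1) i) < Sum.elim (fun j => z (Fin.natAdd (b + 1) j)) (fun c => ∑ i', (c.1 i' : ℝ) * z (Fin.castAdd k i') + (c.2 : ℝ)) (hi i)} ∧ EqOn s.integrand (fun z => MvPolynomial.aeval (fun i => z (Fin.castAdd k (Fin.castSucc i))) p / (∏ j, (∑ i, ((L j).1 i : ℝ) * z (Fin.castAdd k (Fin.castSucc i)) + ((L j).2 : ℝ)) ^ e j) * ((z (Fin.castAdd k (Fin.last b)) - (∑ i, (ℓ₁.1 i : ℝ) * z (Fin.castAdd k (Fin.castSucc i)) + (ℓ₁.2 : ℝ))) ^ n₁ / (z (Fin.castAdd k (Fin.last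 b)) - (∑ i, (ℓ₂.1 i : ℝ) * z (Fin.castAdd k (Fin.castSucc i)) + (ℓ₂.2 : ℝ))) ^ n₂) * ∏ i, (a i).elim 1 (fun c => 1 / (z (Fin.natAdd (b + 1) i) - (∑ i', (c.1 i' : ℝ) * z (Fin.castAdd k i') + (c.2 : ℝ))))) s.domain ∧ w = KZ.of s}) (k : ℕ) : ∀ x ∈ JJ 1 k, ∃ c ∈ AddSubgroup.closure (GG 0 1 k), x - c ∈ KZ.relations := by
  classical
  intro x hx
  rw [hJJ] at hx
  obtain ⟨m, m', s, M, L, e, p, a, lo, hi, hbd, hdom, hint, rfl⟩ := hx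
  have hGG0 : GG 0 1 k = SepZero.GGlit 0 1 k := hGG 0 1 k
  rw [hGG0]
  exact SepZero.main_congruence s M L e p a lo hi hbd hdom hint

end Summit.KontsevichZagierPeriods.ArrangementNormalForm.JanusBands
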